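/-
Copyright (c) 2026. All rights reserved.
Released under Apache 2.0 license as described in the file LICENSE.
Authors: abc-iut cell, seat abc-iut-f-072 (F fact-proving wave, tranche 72: FACT-LIST row F-0312
`Lemma44Property`).
-/
import Literature.AnabelianGeometry.AbsoluteAnabelian.AbsTopIII.AutHolLogFrobeniusModelProofs
import Mathlib.CategoryTheory.PUnit
import HarnessLib

/-!
# [AbsTopIII] Lemma 4.4 / Cor 4.5 (iv): the `Lemma44Property` of the input data — the printed instance
# (archimedean model) PROVED from the printed non-injectivity, and the universal closure REFUTED

S. Mochizuki, *Topics in absolute anabelian geometry III* [MochizukiAbsTopIII2015] (kurims manuscript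
`paper:url-5493eb38cbb7`).  Lemma 4.4 p. 107 (Topological Distinguishability of Additive and
Multiplicative Structures): "Let `k` be a CAF [...]. Then [...] no composite of the form
`k^× →α (k∼)^× ↪ k∼ ↠ k^×` — where [...] `α` is an isomorphism of topological groups; `↪` is the
natural inclusion; `↠` is the natural map — is bijective.  Proof. Indeed, the non-injectivity of
`k∼ ↠ k^×` implies that the composite under consideration fails to be injective."  Proof of Cor 4.5
(iv) p. 110: "by writing out explicitly the meaning of such an equality `ζ'₁ = id`, we conclude that we
obtain a contradiction to Lemma 4.4."

PROOF-ONLY companion of `AutHolLogFrobeniusIncompatibility.lean` (abc-iut-L4-t10), whose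
`Lemma44Property ι` — for abstract input data `Δ : LogFrobeniusData` and `ι : λ^∼ → λ^×`: at every
first-row object `x` and every ISOMORPHISM `a : id_{⋎+1}(x) ⥲ id_⋎(log x)`, the composite
`λ^×(a) ≫ ι_log,⋎(x) ≫ ι_×` is not the identity — is FACT-LIST row F-0312, a SCHEMA over `(Δ, ι)`.  Per
plan R5 the deliverable is: the universal closure decided, the instance form at the named instance
proved.  Contents:

* `AbsTopIII.arch_lemma44_not_injective` — **the printed conclusion of Lemma 4.4 at the archimedean
  model** `archLogFrobeniusData 𝔄` (abc-iut-L4-t14 and -t10's realisation of Def 4.1: `𝒳 = 𝒞^hol_TF`,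
  `𝒩 = 𝒞^hol_TH`, `ι_log`, `ι_×` over the Cor 2.7 interface `𝔄 : AutHolFieldFunctor`): read through the
  underlying-arithmetic-datum functor `𝒞^hol_TH ⥤ Type`, the composite `λ^×(a) ≫ ι_log ≫ ι_×` is
  `z ↦ exp_k(a_M z)` on `k^×` and is NOT INJECTIVE (`exp_k` identifies two distinct non-zero elements,
  abc-iut-w5-d210's `IsCAF.exists_ne_univCover_eq`; `a_M` is a field automorphism).  This is the
  argument inside abc-iut-L4-t10's `arch_lemma44Property`, exposed as the statement print proves
  ("fails to be injective"), hence also `arch_lemma44_not_bijective` ("is [not] bijective");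
* `AbsTopIII.lemma44Property_holds` — **INSTANCE FORM of F-0312**: `Lemma44Property` for the
  archimedean model and its `ι_×` (the instance every consumer in the tree is fed:
  `incompatibleStmt_of_lemma44`, `cor_4_5_iv_of_lemma44`, `cor_4_5_of_inputs` ↦ `cor_4_5_arch`), from
  the previous item by abc-iut-w5-d210's `lemma44Property_of_not_bijective`;
* `AbsTopIII.not_forall_lemma44Property` — **the universal closure of F-0312 is FALSE**: for the input
  datum all of whose categories are the one-object discrete category (so that `𝒩` has only identity
  morphisms) the forbidden composite IS the identity.  R5: the row is a fact AT NAMED INSTANCES ONLY —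
  for abstract data `Lemma44Property` is a genuine hypothesis (it is what Lemma 4.4 supplies for the
  data of Def 4.1), exactly as abc-iut-L4-t10 typed it.

HONEST FRAMING: refereed pre-IUT anabelian geometry ([AbsTopIII] §4); the existence of the interface
`𝔄` on the geometric carriers (Cor 2.7) is NOT asserted; nothing here bears on [IUTchIII] Cor. 3.12 (no
side taken); typed ≠ proved except for the theorems of this file.
-/

set_option autoImplicit false

namespace Literature.AnabelianGeometry.AbsoluteAnabelian.AbsTopIII

open _root_.CategoryTheory

universe u

variable (𝔄 : AutHolFieldFunctor.{u})

/-- **Lemma 4.4 at the archimedean model, as printed ("fails to be injective").**  For every first-row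
object `(𝕏 ↶ k)` of `archLogFrobeniusData 𝔄` and every isomorphism `a`, the composite
`λ^×(a) ≫ ι_log ≫ ι_×` — "`k^× →α (k∼)^× ↪ k∼ ↠ k^×`" — read on the underlying arithmetic datum `k^×`
(the functor `HolTHPair.forget`) is `z ↦ exp_k(a_M z)` and is NOT injective: `exp_k` takes the same
value at two distinct non-zero elements (`IsCAF.exists_ne_univCover_eq`), whose preimages under the
field automorphism `a_M` are distinct non-zero elements of `k^×` with the same image.
[cite: MochizukiAbsTopIII2015, Lemma 4.4 p.107] -/
theorem arch_lemma44_not_injective (x : (archLogFrobeniusData 𝔄).X₁)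
    (a : (archLogFrobeniusData 𝔄).toNexus.obj x ⟶
      (archLogFrobeniusData 𝔄).toNexus.obj ((archLogFrobeniusData 𝔄).log.obj x)) [IsIso a] :
    ¬ Function.Injective ((HolTHPair.forget 𝔄).map
        ((archLogFrobeniusData 𝔄).lamTimes.map a ≫ ιlogApp x ≫
          (HolTFPair.iotaTimes 𝔄).app ((archLogFrobeniusData 𝔄).toNexus.obj x))) := by
  intro hinj
  haveI : CharZero (HolTFPair.k x) := HolTFPair.charZero_k x
  -- two distinct nonzero elements with the same exponential
  obtain ⟨x₀, y₀, hx₀, hy₀, hne, hexp⟩ := IsCAF.exists_ne_univCover_eq (HolTFPair.isCAF x)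
  -- the arithmetic part of the isomorphism `a` is surjective
  have hsurj : ∀ m : HolTFPair.k x, HolTFPair.Hom.arith a (HolTFPair.Hom.arith (inv a) m) = m := by
    intro m
    have h := congrArg (fun φ => HolTFPair.Hom.arith φ m) (IsIso.inv_hom_id a)
    exact h
  set z₁ : HolTFPair.k x := HolTFPair.Hom.arith (inv a) x₀ with hz₁
  set z₂ : HolTFPair.k x := HolTFPair.Hom.arith (inv a) y₀ with hz₂
  have hz₁0 : z₁ ≠ 0 := (map_ne_zero_iff _ (HolTFPair.Hom.arith (inv a)).injective).mpr hx₀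
  have hz₂0 : z₂ ≠ 0 := (map_ne_zero_iff _ (HolTFPair.Hom.arith (inv a)).injective).mpr hy₀
  have hz : z₁ ≠ z₂ := fun h => hne (by rw [← hsurj x₀, ← hsurj y₀, ← hz₁, ← hz₂, h])
  apply hz
  have hval := hinj (a₁ := ⟨z₁, hz₁0⟩) (a₂ := ⟨z₂, hz₂0⟩) (Subtype.ext (by
    rw [HolTHPair.forget_map_apply_coe, HolTHPair.forget_map_apply_coe]
    change @univCover (HolTFPair.k x) _ (HolTFPair.charZero_k x) (HolTFPair.Hom.arith a z₁) =
      @univCover (HolTFPair.k x) _ (HolTFPair.charZero_k x) (HolTFPair.Hom.arith a z₂)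
    rw [hz₁, hz₂, hsurj, hsurj]
    exact hexp))
  exact congrArg Subtype.val hval

/-- **Lemma 4.4 at the archimedean model, verbatim form ("no composite … is bijective").**
[cite: MochizukiAbsTopIII2015, Lemma 4.4 p.107] -/
theorem arch_lemma44_not_bijective (x : (archLogFrobeniusData 𝔄).X₁)
    (a : (archLogFrobeniusData 𝔄).toNexus.obj x ⟶
      (archLogFrobeniusData 𝔄).toNexus.obj ((archLogFrobeniusData 𝔄).log.obj x)) [IsIso a] :
    ¬ Function.Bijective ((HolTHPair.forget 𝔄).map
        ((archLogFrobeniusData 𝔄).lamTimes.map a ≫ ιlogApp x ≫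
          (HolTFPair.iotaTimes 𝔄).app ((archLogFrobeniusData 𝔄).toNexus.obj x))) :=
  fun h => arch_lemma44_not_injective 𝔄 x a h.1

/-- **INSTANCE FORM of FACT-LIST row F-0312 (`Lemma44Property`) at the named instance** — the
archimedean model `archLogFrobeniusData 𝔄` of Def 4.1 with its `ι_× : λ^∼ → λ^×`: for every first-row
object and every isomorphism `a`, the composite `λ^×(a) ≫ ι_log ≫ ι_×` is not the identity ("writing out
explicitly the meaning of such an equality `ζ'₁ = id` … a contradiction to Lemma 4.4", proof of Cor 4.5
(iv) p. 110), because on `k^×` it is not even injective (`arch_lemma44_not_injective`).  This is the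
hypothesis `h44` fed to `incompatibleStmt_of_lemma44` / `cor_4_5_of_inputs` by `cor_4_5_arch`; the
universal closure over abstract data is false (`not_forall_lemma44Property`).
[cite: MochizukiAbsTopIII2015, Lemma 4.4 p.107] -/
theorem lemma44Property_holds :
    Literature.AnabelianGeometry.AbsoluteAnabelian.AbsTopIII.Lemma44Property
      (Δ := archLogFrobeniusData 𝔄) (HolTFPair.iotaTimes 𝔄) :=
  lemma44Property_of_not_bijective (Δ := archLogFrobeniusData 𝔄) (HolTFPair.iotaTimes 𝔄)
    (HolTHPair.forget 𝔄) fun x a ha => by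
      haveI := ha
      exact arch_lemma44_not_bijective 𝔄 x a

/-- **The universal closure of FACT-LIST row F-0312 is false**: `Lemma44Property` fails for SOME
log-Frobenius input datum — the one all of whose categories (first row, `□`, `𝒩`, `ℰ`, `𝒜`) are the
one-object discrete category, with `log`, `id_⋎`, `λ^×`, `λ^∼` identity functors and `ι_log`, `ι_×` the
unique natural transformations: there `𝒩` has only identity morphisms, so at the unique first-row object
and the identity isomorphism the forbidden composite `λ^×(a) ≫ ι_log ≫ ι_×` IS the identity.  R5: the
row is a fact at NAMED instances only (`lemma44Property_holds`); for abstract data it is precisely the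
hypothesis that Lemma 4.4 discharges for the data of Def 4.1 (a toy, it says nothing about print).
[cite: MochizukiAbsTopIII2015, Lemma 4.4 p.107] -/
theorem not_forall_lemma44Property :
    ¬ ∀ (Δ : LogFrobeniusData.{0}) (ι : Δ.lamPf ⟶ Δ.lamTimes),
        Literature.AnabelianGeometry.AbsoluteAnabelian.AbsTopIII.Lemma44Property ι := by
  intro h
  let Δ : LogFrobeniusData.{0} :=
    { X₁ := Discrete PUnit.{1}, X := Discrete PUnit.{1}, toNexus := 𝟭 _, N := Discrete PUnit.{1},
      E := Discrete PUnit.{1}, A := Discrete PUnit.{1},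
      log := 𝟭 _, logIsoId := Iso.refl _,
      lamTimes := 𝟭 _, lamPf := 𝟭 _,
      ιlog := (Functor.punitExt _ _).hom, ιtimes := Sum.inr (Functor.punitExt _ _).hom,
      XtoE := 𝟭 _, NtoE := 𝟭 _,
      lamTimes_NtoE := Functor.punit_ext' _ _, lamPf_NtoE := Functor.punit_ext' _ _,
      κ := 𝟭 _, AtoE := 𝟭 _, κ_equiv := inferInstance, κ_inv := Functor.punitExt _ _,
      φ := 𝟭 _, φ_equiv := inferInstance, η := Functor.punitExt _ _ }
  exact h Δ (Functor.punitExt _ _).hom ⟨PUnit.unit⟩ (𝟙 _) inferInstance (Subsingleton.elim _ _)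

end Literature.AnabelianGeometry.AbsoluteAnabelian.AbsTopIII
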